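import Literature.NumberTheory.Sieve.SmoothCountDeBruijnStep
import Literature.NumberTheory.Sieve.SmoothCountDeBruijnBase
import Literature.NumberTheory.Sieve.SmoothLocalBehaviourHTProofs
import HarnessLib

/-!
# De Bruijn's asymptotic `Ψ(x, y) = xρ(u)(1 + O((u² + 1)/log y))` for `u ≤ c √(log y)` (Hildebrand's method)

Topic `Literature/NumberTheory/Sieve`; a PROVED tool file toward `Literature.NumberTheory.Sieve.HTLocalBehaviour`
(Hildebrand–Tenenbaum 1986, Theorem 3) in the range of small `u = log x/log y`, where the saddle-point method is
replaced by de Bruijn's approximation `Ψ(x, y) ∼ xρ(u)` ([HildebrandTenenbaum1986, (1.5)], proved in the range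
(1.7) in [Hildebrand1986, Thm 1]). We prove a crude but sufficient version of [Hildebrand1986, Thm 1] by
Hildebrand's induction [Hildebrand1986, §3]: from the initial range `y ≤ x ≤ y²`
(`HildebrandInduction.abs_card_sub_mul_dickmanRho_le_base`) and the inductive inequality
(`HildebrandInduction.abs_card_sub_model_le_step`), by strong induction on `⌊x⌋` with the explicit majorant
`D(u² + 1)/log y` (the primes `p ≤ √y`, whose quotients `x/p` may lie in the same range as `x`, carry only half of
the weight, so the majorant closes up):

* `abs_card_sub_mul_dickmanRho_le` — **the theorem**: there are `C`, `c > 0`, `y₀` with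
  `|Ψ(x, y) - xρ(u)| ≤ C (u² + 1)/log y · xρ(u)` for `y ≥ y₀`, `x ≥ y`, `u² ≤ c log y` (`u = log x/log y`).

## References

* [Hildebrand1986] A. Hildebrand, *On the number of positive integers ≤ x and free of prime factors > y*,
  J. Number Theory 22 (1986) 289–307, Theorem 1 and §3.
* [HildebrandTenenbaum1986] A. Hildebrand, G. Tenenbaum, Trans. AMS 296 (1986) 265–290, §1 (1.5)–(1.7).
-/

noncomputable section

open Real Finset

namespace Literature.NumberTheory.Sieve

namespace HildebrandInduction

/-- `ρ(u) ≥ 3/10` for `u ≤ 2` (`ρ(2) = 1 - log 2`). [folklore] -/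
theorem three_tenths_le_dickmanRho {u : ℝ} (hu : u ≤ 2) : 3 / 10 ≤ dickmanRho u := by
  have h2 : dickmanRho 2 = 1 - Real.log 2 := dickmanRho_eq_one_sub_log ⟨by norm_num, le_rfl⟩
  have := Real.log_two_lt_d9
  calc (3 : ℝ) / 10 ≤ dickmanRho 2 := by rw [h2]; linarith
    _ ≤ dickmanRho u := dickmanRho_antitone hu

end HildebrandInduction

open HildebrandInduction in
set_option maxHeartbeats 1600000 in
/-- **De Bruijn's asymptotic by Hildebrand's method (crude form).** There are `C`, `c > 0` and `y₀` such that for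
all natural `y ≥ y₀` and real `x ≥ y` with `u² ≤ c log y`, `u = log x/log y`:
`|Ψ(x, y) - xρ(u)| ≤ C (u² + 1)/log y · xρ(u)`.
([Hildebrand1986, Thm 1] gives `O_ε(log(u+1)/log y)` for `u ≤ exp((log y)^{3/5-ε})`; the present rate and range
come from using only `θ(t) = t + O(t/log² t)` and `ρ(u - 1) ≤ 4u²ρ(u)`.)
[cite: Hildebrand1986, Theorem 1 and §3; HildebrandTenenbaum1986, (1.5)] -/
theorem abs_card_sub_mul_dickmanRho_le :
    ∃ C c : ℝ, 0 < c ∧ ∃ y₀ : ℕ, ∀ (y : ℕ) (x : ℝ), y₀ ≤ y → (y : ℝ) ≤ x →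
      (Real.log x / Real.log y) ^ 2 ≤ c * Real.log y →
      |((Nat.smoothNumbersUpTo ⌊x⌋₊ (y + 1)).card : ℝ) - x * dickmanRho (Real.log x / Real.log y)| ≤
        C * ((Real.log x / Real.log y) ^ 2 + 1) / Real.log y * (x * dickmanRho (Real.log x / Real.log y)) := by
  obtain ⟨Cb, hCb0, hbase⟩ := abs_card_sub_mul_dickmanRho_le_base
  obtain ⟨Cs, hCs0, hstep⟩ := abs_card_sub_model_le_step
  set D : ℝ := 4 * Cs + 4 * Cb + 1 with hD
  have hD0 : 0 < D := by positivity
  have hD1 : 1 ≤ D := by rw [hD]; linarith [hCs0, hCb0]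
  refine ⟨D, 1 / (16 * (D + 1)), by positivity, ⌈Real.exp (8 * (D + 1))⌉₊, fun y x hy hyx huc => ?_⟩
  -- the size of `y`
  have hye : Real.exp (8 * (D + 1)) ≤ y := le_trans (Nat.le_ceil _) (by exact_mod_cast hy)
  have he16 : (16 : ℝ) + 1 ≤ Real.exp (8 * (D + 1)) := by
    have := Real.add_one_le_exp (8 * (D + 1)); nlinarith
  have hy4r : (4 : ℝ) ≤ y := by linarith
  have hy4 : 4 ≤ y := by exact_mod_cast hy4r
  have hy3 : 3 ≤ y := le_trans (by norm_num) hy4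
  have hy0 : (0 : ℝ) < y := by linarith
  set L := Real.log y with hL
  have hL8 : 8 * (D + 1) ≤ L := by
    have := Real.log_le_log (Real.exp_pos _) hye; rwa [Real.log_exp] at this
  have hL0 : 0 < L := by nlinarith
  set c : ℝ := 1 / (16 * (D + 1)) with hc
  -- the claim, by strong induction on `⌊t⌋`
  have key : ∀ n : ℕ, ∀ t : ℝ, ⌊t⌋₊ = n → (y : ℝ) ≤ t → (Real.log t / L) ^ 2 ≤ c * L →
      |((Nat.smoothNumbersUpTo ⌊t⌋₊ (y + 1)).card : ℝ) - t * dickmanRho (Real.log t / L)| ≤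
        D * ((Real.log t / L) ^ 2 + 1) / L * (t * dickmanRho (Real.log t / L)) := by
    intro n
    induction n using Nat.strong_induction_on with
    | _ n ih =>
    intro t htn hyt huc
    have ht0 : 0 < t := lt_of_lt_of_le hy0 hyt
    set u := Real.log t / L with hu
    have hlogt : Real.log t = u * L := by rw [hu]; field_simp
    have hu1 : 1 ≤ u := by
      rw [hu, le_div_iff₀ hL0, one_mul]; exact Real.log_le_log hy0 hyt
    have hρ0 : 0 < dickmanRho u := dickmanRho_pos u
    -- range consequences
    have hcL : c * L = L / (16 * (D + 1)) := by rw [hc]; ring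
    have hu2L : u ^ 2 ≤ L / (16 * (D + 1)) := by rw [← hcL]; exact huc
    have hB1le : D * (u ^ 2 + 1) / L ≤ 1 := by
      rw [div_le_one hL0]
      have h1 : D * u ^ 2 ≤ D * (L / (16 * (D + 1))) := mul_le_mul_of_nonneg_left hu2L hD0.le
      have h2 : D * (L / (16 * (D + 1))) ≤ L / 16 := by
        rw [show D * (L / (16 * (D + 1))) = L / 16 * (D / (D + 1)) by field_simp]
        exact mul_le_of_le_one_right (by positivity) ((div_le_one (by positivity)).2 (by linarith))
      nlinarith
    rcases le_or_gt u 2 with hu2 | hu2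
    · -- the initial range `y ≤ t ≤ y²`
      have hty : t ≤ (y : ℝ) ^ 2 := by
        have h1 : Real.log t ≤ Real.log ((y : ℝ) ^ 2) := by
          rw [Real.log_pow, Nat.cast_ofNat, hlogt, ← hL]; nlinarith
        exact (Real.log_le_log_iff ht0 (by positivity)).1 h1
      have hb := hbase y t hy3 hyt hty
      rw [← hL] at hb
      refine hb.trans ?_
      have hρ := three_tenths_le_dickmanRho hu2
      have h1 : Cb * t / L ≤ 4 * Cb * (1 / L) * (t * (3 / 10)) := by
        rw [show Cb * t / L = Cb * (1 / L) * t by ring]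
        nlinarith [mul_nonneg (mul_nonneg hCb0 (one_div_nonneg.2 hL0.le)) ht0.le]
      have h2 : 4 * Cb * (1 / L) ≤ D * (u ^ 2 + 1) / L := by
        rw [show D * (u ^ 2 + 1) / L = D * (u ^ 2 + 1) * (1 / L) by ring]
        refine mul_le_mul_of_nonneg_right ?_ (by positivity)
        nlinarith [sq_nonneg u]
      calc Cb * t / L ≤ 4 * Cb * (1 / L) * (t * (3 / 10)) := h1
        _ ≤ D * (u ^ 2 + 1) / L * (t * dickmanRho u) := by
            refine mul_le_mul h2 (mul_le_mul_of_nonneg_left hρ ht0.le) (by positivity) (by positivity)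
    · -- the inductive step
      set B₁ := D * (u ^ 2 + 1) / L with hB₁
      set B₂ := D * ((u - 1 / 2) ^ 2 + 1) / L with hB₂
      have hB₂0 : 0 ≤ B₂ := by positivity
      have hB₂₁ : B₂ ≤ B₁ := by
        rw [hB₁, hB₂]
        refine div_le_div_of_nonneg_right (mul_le_mul_of_nonneg_left ?_ hD0.le) hL0.le
        nlinarith
      have ht4 : (4 : ℝ) ≤ t := hy4r.trans hyt
      -- floors of `t' ≤ t/2` are smaller
      have hfloor : ∀ t' : ℝ, 0 ≤ t' → t' ≤ t / 2 → ⌊t'⌋₊ < n := by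
        intro t' ht'0 ht'
        rw [← htn]
        have h1 : (⌊t'⌋₊ : ℝ) ≤ t' := Nat.floor_le ht'0
        have h2 : t < ⌊t⌋₊ + 1 := Nat.lt_floor_add_one t
        have h3 : (⌊t'⌋₊ : ℝ) < ⌊t⌋₊ := by linarith
        exact_mod_cast h3
      -- the bound at smaller `t'`, monotone in `u`
      have hIH : ∀ t' : ℝ, (y : ℝ) ≤ t' → t' ≤ t / 2 → ∀ v : ℝ, Real.log t' / L ≤ v →
          |((Nat.smoothNumbersUpTo ⌊t'⌋₊ (y + 1)).card : ℝ) - t' * dickmanRho (Real.log t' / L)| ≤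
            D * (v ^ 2 + 1) / L * (t' * dickmanRho (Real.log t' / L)) := by
        intro t' hyt' ht' v hv
        have ht'0 : 0 < t' := lt_of_lt_of_le hy0 hyt'
        have hu'1 : 1 ≤ Real.log t' / L := by
          rw [le_div_iff₀ hL0, one_mul]; exact Real.log_le_log hy0 hyt'
        have hu'u : Real.log t' / L ≤ u := by
          rw [hu]; refine div_le_div_of_nonneg_right (Real.log_le_log ht'0 (by linarith)) hL0.le
        have hu'c : (Real.log t' / L) ^ 2 ≤ c * L :=
          le_trans (pow_le_pow_left₀ (by linarith) hu'u 2) huc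
        have h := ih ⌊t'⌋₊ (hfloor t' ht'0.le ht') t' rfl hyt' hu'c
        refine h.trans (mul_le_mul_of_nonneg_right ?_ (by have := dickmanRho_nonneg (Real.log t' / L); positivity))
        refine div_le_div_of_nonneg_right (mul_le_mul_of_nonneg_left ?_ hD0.le) hL0.le
        nlinarith [pow_le_pow_left₀ (by linarith : 0 ≤ Real.log t' / L) hv 2]
      have IH1 : ∀ t' : ℝ, (y : ℝ) ≤ t' → t' ≤ t / 2 →
          |((Nat.smoothNumbersUpTo ⌊t'⌋₊ (y + 1)).card : ℝ) - t' * dickmanRho (Real.log t' / L)| ≤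
            B₁ * (t' * dickmanRho (Real.log t' / L)) := by
        intro t' hyt' ht'
        have ht'0 : 0 < t' := lt_of_lt_of_le hy0 hyt'
        exact hIH t' hyt' ht' u (by rw [hu]; exact div_le_div_of_nonneg_right (Real.log_le_log ht'0 (by linarith)) hL0.le)
      have IH2 : ∀ t' : ℝ, (y : ℝ) ≤ t' → t' ≤ t / Real.sqrt y →
          |((Nat.smoothNumbersUpTo ⌊t'⌋₊ (y + 1)).card : ℝ) - t' * dickmanRho (Real.log t' / L)| ≤
            B₂ * (t' * dickmanRho (Real.log t' / L)) := by
        intro t' hyt' ht'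
        have ht'0 : 0 < t' := lt_of_lt_of_le hy0 hyt'
        have hsq2 : (2 : ℝ) ≤ Real.sqrt y := by
          rw [show (2 : ℝ) = Real.sqrt 4 by rw [show (4 : ℝ) = 2 ^ 2 by norm_num, Real.sqrt_sq (by norm_num)]]
          exact Real.sqrt_le_sqrt hy4r
        have ht'2 : t' ≤ t / 2 := ht'.trans (div_le_div_of_nonneg_left ht0.le two_pos hsq2)
        refine hIH t' hyt' ht'2 (u - 1 / 2) ?_
        have h1 : Real.log t' ≤ Real.log t - L / 2 := by
          have := Real.log_le_log ht'0 ht'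
          rwa [Real.log_div ht0.ne' (Real.sqrt_pos.2 hy0).ne', Real.log_sqrt hy0.le, ← hL] at this
        rw [div_le_iff₀ hL0, sub_mul, ← hlogt]; linarith
      have AP : ∀ t' : ℝ, 0 < t' → t' ≤ t / 2 →
          ((Nat.smoothNumbersUpTo ⌊t'⌋₊ (y + 1)).card : ℝ) ≤ 2 * (t' * dickmanRho (Real.log t' / L)) := by
        intro t' ht'0 ht'
        rcases lt_or_ge t' y with h | h
        · -- `t' < y`: trivial bound, `ρ = 1`
          have hρ : dickmanRho (Real.log t' / L) = 1 := by
            refine dickmanRho_of_le_one ?_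
            rw [div_le_one hL0]; exact Real.log_le_log ht'0 h.le
          rw [hρ, mul_one]
          have := card_smoothNumbersUpTo_le_self ht'0.le y
          linarith
        · have h1 := IH1 t' h ht'
          have hm : 0 ≤ t' * dickmanRho (Real.log t' / L) := by
            have := dickmanRho_nonneg (Real.log t' / L); positivity
          have h2 : B₁ * (t' * dickmanRho (Real.log t' / L)) ≤ 1 * (t' * dickmanRho (Real.log t' / L)) :=
            mul_le_mul_of_nonneg_right hB1le hm
          have := (abs_le.1 h1).2
          linarith
      -- the conditions of the step
      have hcond : 4 * Real.log (4 * u ^ 2) ≤ L := by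
        have h1 : Real.log (4 * u ^ 2) ≤ 4 * u ^ 2 - 1 := Real.log_le_sub_one_of_pos (by positivity)
        have h2 : 16 * u ^ 2 ≤ L := by
          have : L / (16 * (D + 1)) ≤ L / 16 := div_le_div_of_nonneg_left hL0.le (by norm_num) (by nlinarith)
          linarith
        linarith
      have hsmall : Cs * u ≤ L := by
        have h1 : Cs * u ≤ Cs * u ^ 2 := by
          refine mul_le_mul_of_nonneg_left ?_ hCs0; nlinarith
        have h2 : Cs * u ^ 2 ≤ D * u ^ 2 := mul_le_mul_of_nonneg_right (by rw [hD]; linarith) (sq_nonneg u)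
        have h3 : D * u ^ 2 ≤ L := by
          have := (div_le_one hL0).1 hB1le
          nlinarith
        linarith
      have hst := hstep y t B₁ B₂ hy4 ht0 (by rw [← hL, ← hu]; exact hu2) (by rw [← hL, ← hu]; exact hcond)
        (by rw [← hL, ← hu]; exact hsmall) hB₂0 hB₂₁ hB1le
      rw [← hL] at hst
      have hst' := hst IH1 IH2 AP
      rw [← hu] at hst'
      refine hst'.trans (mul_le_mul_of_nonneg_right ?_ (by positivity))
      -- `(B₁ + B₂)/2 + Cs u/L ≤ D (u² + 1)/L`
      rw [hB₁, hB₂]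
      have hkey : D * (u ^ 2 + 1) + D * ((u - 1 / 2) ^ 2 + 1) + 2 * (Cs * u) ≤ 2 * (D * (u ^ 2 + 1)) := by
        have : 4 * Cs ≤ D := by rw [hD]; linarith
        nlinarith
      have e : (D * (u ^ 2 + 1) / L + D * ((u - 1 / 2) ^ 2 + 1) / L) / 2 + Cs * u / L =
          (D * (u ^ 2 + 1) + D * ((u - 1 / 2) ^ 2 + 1) + 2 * (Cs * u)) / (2 * L) := by
        field_simp
      rw [e, div_le_div_iff₀ (by positivity) hL0]
      nlinarith [hkey, hL0]
  exact key ⌊x⌋₊ x rfl hyx (by rw [hL]; exact huc)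

end Literature.NumberTheory.Sieve

end
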